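/-
Copyright (c) 2026. All rights reserved.
Released under Apache 2.0 license as described in the file LICENSE.
Authors: abc-iut cell, prover seat abc-iut-w5-d097 (wave 5), over the statements of abc-iut-L4-t3.
-/
import Literature.AnabelianGeometry.AbsoluteAnabelian.LogFrobeniusObservables
import Literature.AnabelianGeometry.AbsoluteAnabelian.LogFrobeniusCoresProofs
import HarnessLib

/-!
# [AbsTopIII] Corollary 5.5 (iv), first sentence (print-faithful form `Cor55LogWall`): REDUCTION to a
# component-level obstruction of Lemma-3.4 type at one place

S. Mochizuki, *Topics in absolute anabelian geometry III: global reconstruction algorithms*,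
J. Math. Sci. Univ. Tokyo 22 (2015) 939–1156 [MochizukiAbsTopIII2015]; locators = pages of the author's manuscript
(`paper:url-5493eb38cbb7`): Cor 5.5 (iv) p. 131, proof pp. 132–133 ("the incompatibility of the introduction of a
single model `(Γ⃗^log_v)_□` … entirely similar to the proofs of assertion (iv) of Corollaries 3.6, 4.5"), and the proof
of Cor 3.6 (iv) p. 81 l. 27–42: "this core structure determines, for `⋎ ∈ L`, a homotopy `ζ₀` for the pair of paths
`([id_{⋎+1}],[id_⋎]∘[log])`; thus, by composing the result `ζ'₀` of applying `λ^×` to `ζ₀` with the homotopy `ζ₁`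
associated [via `S_log`] to the pair of paths … [of type (1)], we obtain a natural transformation `ζ'₁ = ζ₁ ∘ ζ'₀` …
which, in order for the desired compatibility to hold, must coincide with the homotopy `ζ₂` associated [via `S_log`]
to the pair of paths … [of type (2)].  On the other hand, by writing out explicitly the meaning of such an equality
`ζ'₁ = ζ₂`, we conclude that we obtain a contradiction to Lemma 3.4."

Proof-only companion (no new notion, no named `Prop`) of abc-iut-L4-t3's `LogFrobeniusObservables.lean`, which
types the first sentence of Cor 5.5 (iv) PRINT-FAITHFULLY — no core of `D•_{≤2}` on `D•_{≤1}` is compatible with BOTH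
observables `S_log⊞` and the `TS`-valued `S_log` — as the named fact `LogFrobeniusSetting.Cor55LogWall L T`
(FACT-LIST F-3082).  Here that statement is DERIVED from ONE component-level input at ONE place `v₀`, in the
direction of Cor 3.6 (iv) (the nonarchimedean mechanism; the sibling file `LogFrobeniusLogWallPlusOfObstruction.lean`
does the archimedean direction of Cor 4.5 (iv) for the `S_log⊞`-only form):

* `LogFrobeniusSetting.cor55LogWall_of_twoPathObstruction` — suppose that at `v₀` the graph `Γ⃗^log_{v₀}` (ALL of
  whose arrows carry `TS`-valued homotopies `ι_{v₀,ε}`, Def 5.4 (vii)) has pre-log vertices `νu`, `νm`, `νc` and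
  arrows `ε₁ : νu → νm`, `ε₂ : νm → spaceLink`, `ε₃ : postLog → νc`, `ε₄ : νu → νc` — at a NONARCHIMEDEAN `v₀` these are
  `𝒪^× ↪ k̄^×`, `k̄^× ↪ k̄`, `k~ →(id) k~`, and the shell-arrow `𝒪^× → k~` (the logarithm), cf.
  `exists_logTwoPath_of_eq_false` — so that the pair of paths (`[λ_{νu}]∘[id_{⋎+1}]`, `[λ_{νc}]∘[id_{⋎+1}]`) from
  `𝒳_{⋎+1}` to `𝒩_{v₀}` acquires homotopies in TWO ways in any common family: directly from `ι_{ε₄}` (type (2)), and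
  as the composite of the core homotopy `ζ₀` (whiskered with `λ_{νu}`), `ι_{ε₁}`, `ι_{ε₂}` (whiskered with
  `[id_⋎]∘[log]`) and the post-log homotopy `ι_{ε₃}` (type (1)).  If for some object `x₀` of `𝒳` NO isomorphism
  `a : x₀ ⥲ log(x₀)` makes `λ_{νu}(a) ≫ ι_{ε₁} ≫ ι_{ε₂} ≫ ι_{ε₃}` (components at `log(x₀)`, `log(x₀)`, `x₀`) EQUAL to
  the component of `ι_{ε₄}` at `x₀` — for the genuine theaters at a nonarchimedean place: "the logarithm
  `𝒪^×_{k̄} → k~` is not the restriction of (the additive part of) a field identification `k̄ ⥲ k~`", the content of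
  Lemma 3.4 — then `L.Cor55LogWall T`.
* `exists_logTwoPath_of_eq_false` — at `b = false` the four arrows exist (`unitsToMult`, `multToSpaceLink`,
  `postLogId`, `shell`); `cor55LogWall_of_nonarchObstruction` — the cast-free form at a place with `isArc v₀ = false`.

Refereed pre-IUT material; OUR kernel check of a typed statement; nothing here bears on [IUTchIII] Cor. 3.12;
no side taken.
-/

set_option autoImplicit false

universe u

open CategoryTheory Quiver

namespace Literature.AnabelianGeometry.AbsoluteAnabelian

namespace LogFrobeniusSetting

variable {Vmod : Type u} {isArc : Vmod → Bool} (L : LogFrobeniusSetting Vmod isArc)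

/-- Components of heterogeneously equal natural transformations (between propositionally equal functors) are
heterogeneously equal. [folklore] -/
private theorem app_heq_of_heq_natTrans {C : Type (u + 1)} [Category.{u} C] {D : Type (u + 1)} [Category.{u} D]
    {F G F' G' : C ⥤ D} {α : F ⟶ G} {β : F' ⟶ G'} (h : HEq α β) (hF : F = F') (hG : G = G') (x : C) :
    HEq (α.app x) (β.app x) := by
  subst hF hG
  cases h
  rfl

/-- Components of a natural transformation at propositionally equal objects are heterogeneously equal. [folklore] -/
private theorem app_heq_app {C : Type (u + 1)} [Category.{u} C] {D : Type (u + 1)} [Category.{u} D]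
    {F G : C ⥤ D} (α : F ⟶ G) {x y : C} (h : x = y) : HEq (α.app x) (α.app y) := by
  subst h
  rfl

/-- Images under propositionally equal functors of heterogeneously equal morphisms. [folklore] -/
private theorem map_heq_map {C : Type (u + 1)} [Category.{u} C] {D : Type (u + 1)} [Category.{u} D]
    {F G : C ⥤ D} (hFG : F = G) {a b a' b' : C} (ha : a = a') (hb : b = b') {f : a ⟶ b} {g : a' ⟶ b'}
    (h : HEq f g) : HEq (F.map f) (G.map g) := by
  subst hFG ha hb
  cases h
  rfl

/-- A five-term identity between morphisms transported along heterogeneous equalities of its terms. [folklore] -/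
private theorem eq_of_heq_chain {C : Type (u + 1)} [Category.{u} C] {o₀ o₁ o₂ o₃ o₄ c₀ c₁ c₂ c₃ c₄ : C}
    (h₀ : o₀ = c₀) (h₁ : o₁ = c₁) (h₂ : o₂ = c₂) (h₃ : o₃ = c₃) (h₄ : o₄ = c₄)
    {κ₁ : o₀ ⟶ o₁} {κ₂ : o₁ ⟶ o₂} {κ₃ : o₂ ⟶ o₃} {κ₄ : o₃ ⟶ o₄} {κ₅ : o₀ ⟶ o₄}
    {n₁ : c₀ ⟶ c₁} {n₂ : c₁ ⟶ c₂} {n₃ : c₂ ⟶ c₃} {n₄ : c₃ ⟶ c₄} {n₅ : c₀ ⟶ c₄}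
    (e₁ : HEq κ₁ n₁) (e₂ : HEq κ₂ n₂) (e₃ : HEq κ₃ n₃) (e₄ : HEq κ₄ n₄) (e₅ : HEq κ₅ n₅)
    (key : κ₅ = ((κ₁ ≫ κ₂) ≫ κ₃) ≫ κ₄) : n₁ ≫ n₂ ≫ n₃ ≫ n₄ = n₅ := by
  subst h₀ h₁ h₂ h₃ h₄
  cases e₁; cases e₂; cases e₃; cases e₄; cases e₅
  simpa only [Category.assoc] using key.symm

/-- Components of a homotopy given by the whiskering axiom of Def 3.5 (ii) (b), read heterogeneously.
[folklore] -/
private theorem heq_app_of_eq_whisker {C₁ C₂ C₃ C₄ : Type (u + 1)} [Category.{u} C₁] [Category.{u} C₂]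
    [Category.{u} C₃] [Category.{u} C₄] {F : C₁ ⥤ C₂} {P Q : C₂ ⥤ C₃} {G : C₃ ⥤ C₄} {A B : C₁ ⥤ C₄}
    (η : P ⟶ Q) {θ : A ⟶ B} {E : A = F ⋙ (P ⋙ G)} {E' : F ⋙ (Q ⋙ G) = B}
    (W : θ = eqToHom E ≫ Functor.whiskerLeft F (Functor.whiskerRight η G) ≫ eqToHom E') (x : C₁) :
    HEq (θ.app x) (G.map (η.app (F.obj x))) := by
  subst E E' W
  rw [eqToHom_refl, eqToHom_refl, Category.id_comp, Category.comp_id]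
  rfl

/-- Transport of `IsIso` along a heterogeneous equality of morphisms with propositionally equal endpoints. [folklore] -/
private theorem isIso_of_heq_hom {C : Type*} [Category C] {a b a' b' : C} (ha : a = a') (hb : b = b')
    {f : a ⟶ b} {g : a' ⟶ b'} (h : HEq f g) (hf : IsIso f) : IsIso g := by
  subst ha hb
  cases h
  exact hf

/-- **[AbsTopIII] Cor 5.5 (iv), first sentence (print-faithful `Cor55LogWall`), REDUCED to a component-level
two-path obstruction at one place** (the Cor 3.6 (iv) / Lemma 3.4 mechanism).  Data: a place `v₀`; pre-log vertices
`νu`, `νm`, `νc` of `Γ⃗^log_{v₀}`; arrows `ε₁ : νu → νm`, `ε₂ : νm → spaceLink`, `ε₃ : postLog → νc`, `ε₄ : νu → νc` of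
`Γ⃗^log_{v₀}` (at a nonarchimedean place: `𝒪^× ↪ k̄^×`, `k̄^× ↪ k̄`, `k~ →(id) k~`, `𝒪^× →(log) k~`); an object `x₀` of
`𝒳`.  Hypothesis (components compared by `HEq`, because `Λ_ν = frobeniusTwist` and `λ_{spaceLink} = λ_{postLog}` are
only propositionally the evident functors): for NO isomorphism `a : x₀ ⥲ log(x₀)` of `𝒳` does
`λ_{νu}(a) ≫ m₁ ≫ m₂ ≫ m₃ = m₄` hold with `m₁, m₂` the components of `ι_{ε₁}, ι_{ε₂}` at `log(x₀)` and `m₃, m₄` those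
of `ι_{ε₃}, ι_{ε₄}` at `x₀` ("writing out explicitly the meaning of `ζ'₁ = ζ₂` … a contradiction to Lemma 3.4").
Conclusion: `L.Cor55LogWall T`. [cite: MochizukiAbsTopIII2015, Cor 5.5 (iv) p. 131] -/
theorem cor55LogWall_of_twoPathObstruction (T : L.TSHomotopies) (v₀ : Vmod) (νu νm νc : LogVertex (isArc v₀))
    (hu : νu.isPostLog = false) (hm : νm.isPostLog = false) (hc : νc.isPostLog = false)
    (ε₁ : LogEdgeTS (isArc v₀) νu νm) (ε₂ : LogEdgeTS (isArc v₀) νm (LogVertex.spaceLink (isArc v₀)))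
    (ε₃ : LogEdgeTS (isArc v₀) (LogVertex.postLog (isArc v₀)) νc) (ε₄ : LogEdgeTS (isArc v₀) νu νc) (x₀ : L.X)
    (obstruction : ∀ (a : x₀ ⟶ L.log.obj x₀), IsIso a →
      ∀ (m₁ : (L.lam v₀ νu ⋙ L.forget v₀).obj (L.log.obj x₀) ⟶ (L.lam v₀ νm ⋙ L.forget v₀).obj (L.log.obj x₀))
        (m₂ : (L.lam v₀ νm ⋙ L.forget v₀).obj (L.log.obj x₀) ⟶
          (L.lam v₀ (LogVertex.spaceLink (isArc v₀)) ⋙ L.forget v₀).obj (L.log.obj x₀))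
        (m₃ : (L.lam v₀ (LogVertex.spaceLink (isArc v₀)) ⋙ L.forget v₀).obj (L.log.obj x₀) ⟶
          (L.lam v₀ νc ⋙ L.forget v₀).obj x₀)
        (m₄ : (L.lam v₀ νu ⋙ L.forget v₀).obj x₀ ⟶ (L.lam v₀ νc ⋙ L.forget v₀).obj x₀),
        HEq m₁ ((T.iota v₀ ε₁).app (L.log.obj x₀)) → HEq m₂ ((T.iota v₀ ε₂).app (L.log.obj x₀)) →
        HEq m₃ ((T.iota v₀ ε₃).app x₀) → HEq m₄ ((T.iota v₀ ε₄).app x₀) →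
          (L.lam v₀ νu ⋙ L.forget v₀).map a ≫ m₁ ≫ m₂ ≫ m₃ ≠ m₄) :
    L.Cor55LogWall T := by
  rintro ⟨Hc, hHc, K, Hplus, Hts, hcore, hcK, hobsAll⟩
  obtain ⟨-, ⟨-, hpre, hpost⟩, htsK⟩ := hobsAll v₀
  have hsl : (LogVertex.spaceLink (isArc v₀)).isPostLog = false := spaceLink_isPostLog _
  have hpl : (LogVertex.postLog (isArc v₀)).isPostLog = true := by
    generalize isArc v₀ = b; cases b <;> rfl
  /- (1) the core homotopy `ζ₀` for `([id_1], [id_0]∘[log])`, transported into `K` -/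
  let X₁ : ExtShape.{u} (DSub (DVertex.InFirstRows (Vmod := Vmod) (isArc := isArc) 1)) :=
    obsShape (DVertex.InFirstRows 1) DVertex.core
  let a₁ : X₁.Vertex := X₁.base ⟨.row1 (0 + 1), trivial, le_rfl⟩
  let a₀ : X₁.Vertex := X₁.base ⟨.row1 0, trivial, le_rfl⟩
  let tc1 : a₁ ⟶ X₁.obs := DEdge.toCore (0 + 1)
  let lg : a₁ ⟶ a₀ := DEdge.log 0
  let tc0 : a₀ ⟶ X₁.obs := DEdge.toCore 0
  have hc₀ : Hc.E ((Path.nil : Path a₁ a₁).cons tc1) (((Path.nil : Path a₁ a₁).cons lg).cons tc0) :=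
    hcore.boundary_all _ _
  have hiso₀ : IsIso (Hc.η hc₀) :=
    DiagramOfCategories.HomotopyFamily.isIso_of_isSymmetric _ Hc hcore.isSymmetric hc₀
  obtain ⟨k₀, hk₀⟩ := hcK _ _ hc₀
  -- paths of `D•⊢` used below (all starting at `𝒳_1 = row1 (0+1)` or at `□`)
  let v1 : DVertex Vmod isArc := .row1 (0 + 1)
  let pId1 : Path v1 DVertex.core := (Path.nil : Path v1 v1).cons (DEdge.toCore (0 + 1))
  let pLog : Path v1 DVertex.core := ((Path.nil : Path v1 v1).cons (DEdge.log 0)).cons (DEdge.toCore 0)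
  have k₀' : K.E pId1 pLog := k₀
  have hisoK : IsIso (K.η k₀') := by
    refine isIso_of_heq_hom ?_ ?_ hk₀ hiso₀
    · simp only [pId1, DiagramOfCategories.pathFunctor_cons, DiagramOfCategories.pathFunctor_nil]; rfl
    · simp only [pLog, DiagramOfCategories.pathFunctor_cons, DiagramOfCategories.pathFunctor_nil]; rfl
  /- (2) the four `TS`-pins at `v₀`, transported into `K` -/
  obtain ⟨hm₁, hpin₁⟩ := hpre νu νm ε₁ hu hm
  obtain ⟨hm₂, hpin₂⟩ := hpre νm (LogVertex.spaceLink (isArc v₀)) ε₂ hm hsl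
  obtain ⟨hm₃, hpin₃⟩ := hpost (LogVertex.postLog (isArc v₀)) νc ε₃ hpl hc hsl 0
  obtain ⟨hm₄, hpin₄⟩ := hpre νu νc ε₄ hu hc
  obtain ⟨t₁, ht₁⟩ := htsK _ _ hm₁
  obtain ⟨t₂, ht₂⟩ := htsK _ _ hm₂
  obtain ⟨t₃, ht₃⟩ := htsK _ _ hm₃
  obtain ⟨t₄, ht₄⟩ := htsK _ _ hm₄
  -- the `λ`-paths `[λ⊞_{ν}; 𝒩⊞ → 𝒩]` of `D•⊢`
  let lamP : ∀ (ν : LogVertex (isArc v₀)) (hν : ν.isPostLog = false),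
      Path (DVertex.core : DVertex Vmod isArc) (DVertex.nv v₀) :=
    fun ν hν => ((Path.nil : Path (DVertex.core : DVertex Vmod isArc) DVertex.core).cons
      (DEdge.lam v₀ ν hν)).cons (DEdge.forget v₀)
  have t₁' : K.E (lamP νu hu) (lamP νm hm) := t₁
  have t₂' : K.E (lamP νm hm) (lamP _ hsl) := t₂
  have t₃' : K.E (pLog.comp (lamP _ hsl)) (pId1.comp (lamP νc hc)) := t₃
  have t₄' : K.E (lamP νu hu) (lamP νc hc) := t₄
  /- (3) the two derivations of the pair `([λ_{νu}]∘[id_1], [λ_{νc}]∘[id_1])` -/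
  have s1 : K.E (pId1.comp (lamP νu hu)) (pLog.comp (lamP νu hu)) :=
    K.isSaturated.precomp (K.isSaturated.postcomp k₀' (lamP νu hu)) Path.nil
  have s2 : K.E (pLog.comp (lamP νu hu)) (pLog.comp (lamP νm hm)) :=
    K.isSaturated.precomp (K.isSaturated.postcomp t₁' Path.nil) pLog
  have s3 : K.E (pLog.comp (lamP νm hm)) (pLog.comp (lamP _ hsl)) :=
    K.isSaturated.precomp (K.isSaturated.postcomp t₂' Path.nil) pLog
  have s5 : K.E (pId1.comp (lamP νu hu)) (pId1.comp (lamP νc hc)) :=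
    K.isSaturated.precomp (K.isSaturated.postcomp t₄' Path.nil) pId1
  -- `ζ'₁ = ζ₂`: two homotopies of ONE pair of paths coincide (a family assigns one homotopy per pair)
  have key : K.η s5 = ((K.η s1 ≫ K.η s2) ≫ K.η s3) ≫ K.η t₃' := by
    rw [← K.η_trans s1 s2, ← K.η_trans, ← K.η_trans]
  have keyx : (K.η s5).app x₀ = (((K.η s1).app x₀ ≫ (K.η s2).app x₀) ≫ (K.η s3).app x₀) ≫ (K.η t₃').app x₀ := by
    have := NatTrans.congr_app key x₀
    simpa only [NatTrans.comp_app] using this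
  /- (4) functor identities along the explicit paths (the path functors are recursive: propositional only) -/
  have E_nil : L.diagram.pathFunctor (Path.nil : Path v1 v1) = 𝟭 L.X := DiagramOfCategories.pathFunctor_nil _ _
  have E_id1 : L.diagram.pathFunctor pId1 = 𝟭 L.X := by
    simp only [pId1, DiagramOfCategories.pathFunctor_cons, DiagramOfCategories.pathFunctor_nil]; rfl
  have E_log : L.diagram.pathFunctor pLog = L.log := by
    simp only [pLog, DiagramOfCategories.pathFunctor_cons, DiagramOfCategories.pathFunctor_nil]; rfl
  have Q : ∀ (ν : LogVertex (isArc v₀)) (hν : ν.isPostLog = false),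
      L.diagram.pathFunctor (lamP ν hν) = L.lam v₀ ν ⋙ L.forget v₀ := by
    intro ν hν
    simp only [lamP, DiagramOfCategories.pathFunctor_cons, DiagramOfCategories.pathFunctor_nil]; rfl
  have E1c : ∀ (ν : LogVertex (isArc v₀)) (hν : ν.isPostLog = false),
      L.diagram.pathFunctor (pId1.comp (lamP ν hν)) = L.lam v₀ ν ⋙ L.forget v₀ := by
    intro ν hν
    simp only [pId1, lamP, Path.comp_cons, Path.comp_nil, DiagramOfCategories.pathFunctor_cons,
      DiagramOfCategories.pathFunctor_nil]; rfl
  have ELc : ∀ (ν : LogVertex (isArc v₀)) (hν : ν.isPostLog = false),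
      L.diagram.pathFunctor (pLog.comp (lamP ν hν)) = L.log ⋙ (L.lam v₀ ν ⋙ L.forget v₀) := by
    intro ν hν
    simp only [pLog, lamP, Path.comp_cons, Path.comp_nil, DiagramOfCategories.pathFunctor_cons,
      DiagramOfCategories.pathFunctor_nil]; rfl
  have PTS : ∀ (ν : LogVertex (isArc v₀)) (hν : ν.isPostLog = false),
      (L.logDiagramTS v₀).pathFunctor (lamPathTS v₀ ν hν) = L.lam v₀ ν ⋙ L.forget v₀ := by
    intro ν hν
    simp only [lamPathTS, lamEdgeTS, forgetEdgeTS, DiagramOfCategories.pathFunctor_cons,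
      DiagramOfCategories.pathFunctor_nil]; rfl
  have PTSd : (L.logDiagramTS v₀).pathFunctor (postLogDomPathTS v₀ 0 hsl) =
      L.log ⋙ (L.lam v₀ (LogVertex.spaceLink (isArc v₀)) ⋙ L.forget v₀) := by
    simp only [postLogDomPathTS, logEdgeTS, toCoreEdgeTS, lamEdgeTS, forgetEdgeTS,
      DiagramOfCategories.pathFunctor_cons, DiagramOfCategories.pathFunctor_nil]; rfl
  have PTSc : (L.logDiagramTS v₀).pathFunctor (postLogCodPathTS v₀ 0 νc hc) = L.lam v₀ νc ⋙ L.forget v₀ := by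
    simp only [postLogCodPathTS, toCoreEdgeTS, lamEdgeTS, forgetEdgeTS, DiagramOfCategories.pathFunctor_cons,
      DiagramOfCategories.pathFunctor_nil]; rfl
  /- (5) the five factors, heterogeneously: ζ'₀ = λ_{νu}(ζ₀), ι_{ε₁}, ι_{ε₂} at `log x₀`, ι_{ε₃}, and ζ₂ = ι_{ε₄} at `x₀` -/
  have ht₁' : HEq ((Hts v₀).η hm₁) (K.η t₁') := ht₁
  have ht₂' : HEq ((Hts v₀).η hm₂) (K.η t₂') := ht₂
  have ht₃' : HEq ((Hts v₀).η hm₃) (K.η t₃') := ht₃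
  have ht₄' : HEq ((Hts v₀).η hm₄) (K.η t₄') := ht₄
  -- the pins, as heterogeneous equalities of components of `K`
  have g₁ : ∀ y : L.X, HEq ((K.η t₁').app y) ((T.iota v₀ ε₁).app y) := fun y => by
    obtain ⟨o, o', H⟩ := hpin₁ y
    exact (app_heq_of_heq_natTrans ht₁' ((PTS νu hu).trans (Q νu hu).symm) ((PTS νm hm).trans (Q νm hm).symm) y).symm.trans
      ((conj_eqToHom_iff_heq' _ _ o o').mp H)
  have g₂ : ∀ y : L.X, HEq ((K.η t₂').app y) ((T.iota v₀ ε₂).app y) := fun y => by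
    obtain ⟨o, o', H⟩ := hpin₂ y
    exact (app_heq_of_heq_natTrans ht₂' ((PTS νm hm).trans (Q νm hm).symm) ((PTS _ hsl).trans (Q _ hsl).symm) y).symm.trans
      ((conj_eqToHom_iff_heq' _ _ o o').mp H)
  have g₃ : HEq ((K.η t₃').app x₀) ((T.iota v₀ ε₃).app x₀) := by
    obtain ⟨o, o', H⟩ := hpin₃ x₀
    exact (app_heq_of_heq_natTrans ht₃' (PTSd.trans (ELc _ hsl).symm) (PTSc.trans (E1c νc hc).symm) x₀).symm.trans
      ((conj_eqToHom_iff_heq' _ _ o o').mp H)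
  have g₄ : ∀ y : L.X, HEq ((K.η t₄').app y) ((T.iota v₀ ε₄).app y) := fun y => by
    obtain ⟨o, o', H⟩ := hpin₄ y
    exact (app_heq_of_heq_natTrans ht₄' ((PTS νu hu).trans (Q νu hu).symm) ((PTS νc hc).trans (Q νc hc).symm) y).symm.trans
      ((conj_eqToHom_iff_heq' _ _ o o').mp H)
  -- object identities at `x₀`
  have hx_nil : (L.diagram.pathFunctor (Path.nil : Path v1 v1)).obj x₀ = x₀ := Functor.congr_obj E_nil x₀
  have hx_id1 : (L.diagram.pathFunctor pId1).obj x₀ = x₀ := Functor.congr_obj E_id1 x₀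
  have hx_log : (L.diagram.pathFunctor pLog).obj x₀ = L.log.obj x₀ := Functor.congr_obj E_log x₀
  -- the isomorphism `α = ζ₀(x₀) : x₀ ⥲ log(x₀)`
  haveI := hisoK
  obtain ⟨a, ha⟩ : ∃ a : x₀ ⟶ L.log.obj x₀, a = eqToHom hx_id1.symm ≫ (K.η k₀').app x₀ ≫ eqToHom hx_log :=
    ⟨_, rfl⟩
  have ha_iso : IsIso a :=
    isIso_of_heq_hom hx_id1 hx_log ((conj_eqToHom_iff_heq' _ _ hx_id1.symm hx_log).mp ha).symm inferInstance
  have ha_heq : HEq ((K.η k₀').app ((L.diagram.pathFunctor (Path.nil : Path v1 v1)).obj x₀)) a :=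
    (app_heq_app (K.η k₀') hx_nil).trans ((conj_eqToHom_iff_heq' _ _ hx_id1.symm hx_log).mp ha).symm
  have E_nilN : L.diagram.pathFunctor (Path.nil : Path (DVertex.nv v₀ : DVertex Vmod isArc) (DVertex.nv v₀)) = 𝟭 _ :=
    DiagramOfCategories.pathFunctor_nil _ _
  -- (e1) ζ'₀ at `x₀` is `λ_{νu}(α)`
  have e1 : HEq ((K.η s1).app x₀) ((L.lam v₀ νu ⋙ L.forget v₀).map a) :=
    (heq_app_of_eq_whisker (K.η k₀') (K.η_whisker k₀' Path.nil (lamP νu hu)) x₀).trans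
      (map_heq_map (Q νu hu) ((Functor.congr_obj E_id1 _).trans hx_nil)
        ((Functor.congr_obj E_log _).trans (congrArg L.log.obj hx_nil)) ha_heq)
  -- (e2), (e3) `ι_{ε₁}`, `ι_{ε₂}` at `log x₀` (pre-composed with `[id_0]∘[log]`)
  have e2 : HEq ((K.η s2).app x₀) ((T.iota v₀ ε₁).app (L.log.obj x₀)) :=
    (heq_app_of_eq_whisker (K.η t₁') (K.η_whisker t₁' pLog Path.nil) x₀).trans
      (map_heq_map E_nilN (by rw [Functor.congr_obj (Q νu hu), hx_log, hu]; rfl)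
        (by rw [Functor.congr_obj (Q νm hm), hx_log]) ((app_heq_app (K.η t₁') hx_log).trans (g₁ _)))
  have e3 : HEq ((K.η s3).app x₀) ((T.iota v₀ ε₂).app (L.log.obj x₀)) :=
    (heq_app_of_eq_whisker (K.η t₂') (K.η_whisker t₂' pLog Path.nil) x₀).trans
      (map_heq_map E_nilN (by rw [Functor.congr_obj (Q νm hm), hx_log, hm]; rfl)
        (by rw [Functor.congr_obj (Q _ hsl), hx_log]) ((app_heq_app (K.η t₂') hx_log).trans (g₂ _)))
  -- (e5) ζ₂ = `ι_{ε₄}` at `x₀` (pre-composed with `[id_1]`)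
  have e5 : HEq ((K.η s5).app x₀) ((T.iota v₀ ε₄).app x₀) :=
    (heq_app_of_eq_whisker (K.η t₄') (K.η_whisker t₄' pId1 Path.nil) x₀).trans
      (map_heq_map E_nilN (by rw [Functor.congr_obj (Q νu hu), hx_id1, hu]; rfl)
        (by rw [Functor.congr_obj (Q νc hc), hx_id1]) ((app_heq_app (K.η t₄') hx_id1).trans (g₄ _)))
  /- (6) "writing out explicitly the meaning of `ζ'₁ = ζ₂`" at `x₀`: transport the five factors to the clean types
  and contradict the obstruction -/
  have h₀ : (L.diagram.pathFunctor (pId1.comp (lamP νu hu))).obj x₀ = (L.lam v₀ νu ⋙ L.forget v₀).obj x₀ :=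
    Functor.congr_obj (E1c νu hu) x₀
  have h₁ : (L.diagram.pathFunctor (pLog.comp (lamP νu hu))).obj x₀ =
      (L.lam v₀ νu ⋙ L.forget v₀).obj (L.log.obj x₀) := Functor.congr_obj (ELc νu hu) x₀
  have h₂ : (L.diagram.pathFunctor (pLog.comp (lamP νm hm))).obj x₀ =
      (L.lam v₀ νm ⋙ L.forget v₀).obj (L.log.obj x₀) := Functor.congr_obj (ELc νm hm) x₀
  have h₃ : (L.diagram.pathFunctor (pLog.comp (lamP _ hsl))).obj x₀ =
      (L.lam v₀ (LogVertex.spaceLink (isArc v₀)) ⋙ L.forget v₀).obj (L.log.obj x₀) :=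
    Functor.congr_obj (ELc _ hsl) x₀
  have h₄ : (L.diagram.pathFunctor (pId1.comp (lamP νc hc))).obj x₀ = (L.lam v₀ νc ⋙ L.forget v₀).obj x₀ :=
    Functor.congr_obj (E1c νc hc) x₀
  obtain ⟨m₁, hm₁⟩ : ∃ m₁ : (L.lam v₀ νu ⋙ L.forget v₀).obj (L.log.obj x₀) ⟶
      (L.lam v₀ νm ⋙ L.forget v₀).obj (L.log.obj x₀), m₁ = eqToHom h₁.symm ≫ (K.η s2).app x₀ ≫ eqToHom h₂ :=
    ⟨_, rfl⟩
  obtain ⟨m₂, hm₂⟩ : ∃ m₂ : (L.lam v₀ νm ⋙ L.forget v₀).obj (L.log.obj x₀) ⟶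
      (L.lam v₀ (LogVertex.spaceLink (isArc v₀)) ⋙ L.forget v₀).obj (L.log.obj x₀),
      m₂ = eqToHom h₂.symm ≫ (K.η s3).app x₀ ≫ eqToHom h₃ := ⟨_, rfl⟩
  obtain ⟨m₃, hm₃⟩ : ∃ m₃ : (L.lam v₀ (LogVertex.spaceLink (isArc v₀)) ⋙ L.forget v₀).obj (L.log.obj x₀) ⟶
      (L.lam v₀ νc ⋙ L.forget v₀).obj x₀, m₃ = eqToHom h₃.symm ≫ (K.η t₃').app x₀ ≫ eqToHom h₄ := ⟨_, rfl⟩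
  obtain ⟨m₄, hm₄⟩ : ∃ m₄ : (L.lam v₀ νu ⋙ L.forget v₀).obj x₀ ⟶ (L.lam v₀ νc ⋙ L.forget v₀).obj x₀,
      m₄ = eqToHom h₀.symm ≫ (K.η s5).app x₀ ≫ eqToHom h₄ := ⟨_, rfl⟩
  have c₁ : HEq ((K.η s2).app x₀) m₁ := ((conj_eqToHom_iff_heq' _ _ h₁.symm h₂).mp hm₁).symm
  have c₂ : HEq ((K.η s3).app x₀) m₂ := ((conj_eqToHom_iff_heq' _ _ h₂.symm h₃).mp hm₂).symm
  have c₃ : HEq ((K.η t₃').app x₀) m₃ := ((conj_eqToHom_iff_heq' _ _ h₃.symm h₄).mp hm₃).symm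
  have c₄ : HEq ((K.η s5).app x₀) m₄ := ((conj_eqToHom_iff_heq' _ _ h₀.symm h₄).mp hm₄).symm
  exact obstruction a ha_iso m₁ m₂ m₃ m₄ (c₁.symm.trans e2) (c₂.symm.trans e3) (c₃.symm.trans g₃)
    (c₄.symm.trans e5) (eq_of_heq_chain h₀ h₁ h₂ h₃ h₄ e1 c₁ c₂ c₃ c₄ keyx)



/-- At a NONARCHIMEDEAN place the graph `Γ⃗^log_non` (Def 5.4 (iii): `𝒪^×_{k̄} ↪ k̄^× ↪ k̄`, `𝒪^× →(log) k~`,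
`k~ →(id) k~`, …; ALL arrows carry `TS`-valued `ι_{v,ε}`, Def 5.4 (vii)) contains the two-path configuration required by
`cor55LogWall_of_twoPathObstruction`: `νu = 𝒪^×`, `νm = k̄^×`, `νc = k~` (shell codomain), arrows `unitsToMult`,
`multToSpaceLink`, `postLogId`, `shell`.  Stated for a Boolean `b = false` so that it applies to `b := isArc v₀`
without transport. [cite: MochizukiAbsTopIII2015, Def 5.4 (iii) p. 126] -/
theorem exists_logTwoPath_of_eq_false (b : Bool) (hb : b = false) :
    ∃ (νu νm νc : LogVertex b) (_ : νu.isPostLog = false) (_ : νm.isPostLog = false) (_ : νc.isPostLog = false),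
      Nonempty (LogEdgeTS b νu νm) ∧ Nonempty (LogEdgeTS b νm (LogVertex.spaceLink b)) ∧
        Nonempty (LogEdgeTS b (LogVertex.postLog b) νc) ∧ Nonempty (LogEdgeTS b νu νc) := by
  subst hb
  exact ⟨NonarchVertex.units, NonarchVertex.mult, NonarchVertex.shellCod, rfl, rfl, rfl,
    ⟨NonarchEdge.unitsToMult⟩, ⟨NonarchEdge.multToSpaceLink⟩, ⟨NonarchEdge.postLogId⟩, ⟨NonarchEdge.shell⟩⟩

/-- **[AbsTopIII] Cor 5.5 (iv), first sentence (`Cor55LogWall`), from the NONARCHIMEDEAN two-path obstruction** (the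
Lemma 3.4 / Cor 3.6 (iv) mechanism at one nonarchimedean place `v₀ ∈ V(F_mod)`): if for some object `x₀` of `𝒳`, for
every two-path configuration `νu → νm → spaceLink`, `postLog → νc`, `νu → νc` of `Γ⃗^log_{v₀}` (at a nonarchimedean
place: the printed one, `exists_logTwoPath_of_eq_false`) and every isomorphism `a : x₀ ⥲ log(x₀)`, the composite
`λ_{νu}(a) ≫ ι_{ε₁} ≫ ι_{ε₂} ≫ ι_{ε₃}` differs from `ι_{ε₄}` at `x₀` ("the logarithm on `𝒪^×_{k̄}` is not the restriction
of a field identification `k̄ ⥲ k~`", Lemma 3.4), then `L.Cor55LogWall T`.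
[cite: MochizukiAbsTopIII2015, Cor 5.5 (iv) p. 131] -/
theorem cor55LogWall_of_nonarchObstruction (T : L.TSHomotopies) (v₀ : Vmod) (hv₀ : isArc v₀ = false) (x₀ : L.X)
    (obstruction : ∀ (νu νm νc : LogVertex (isArc v₀)) (_ : νu.isPostLog = false) (_ : νm.isPostLog = false)
      (_ : νc.isPostLog = false) (ε₁ : LogEdgeTS (isArc v₀) νu νm)
      (ε₂ : LogEdgeTS (isArc v₀) νm (LogVertex.spaceLink (isArc v₀)))
      (ε₃ : LogEdgeTS (isArc v₀) (LogVertex.postLog (isArc v₀)) νc) (ε₄ : LogEdgeTS (isArc v₀) νu νc)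
      (a : x₀ ⟶ L.log.obj x₀), IsIso a →
      ∀ (m₁ : (L.lam v₀ νu ⋙ L.forget v₀).obj (L.log.obj x₀) ⟶ (L.lam v₀ νm ⋙ L.forget v₀).obj (L.log.obj x₀))
        (m₂ : (L.lam v₀ νm ⋙ L.forget v₀).obj (L.log.obj x₀) ⟶
          (L.lam v₀ (LogVertex.spaceLink (isArc v₀)) ⋙ L.forget v₀).obj (L.log.obj x₀))
        (m₃ : (L.lam v₀ (LogVertex.spaceLink (isArc v₀)) ⋙ L.forget v₀).obj (L.log.obj x₀) ⟶
          (L.lam v₀ νc ⋙ L.forget v₀).obj x₀)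
        (m₄ : (L.lam v₀ νu ⋙ L.forget v₀).obj x₀ ⟶ (L.lam v₀ νc ⋙ L.forget v₀).obj x₀),
        HEq m₁ ((T.iota v₀ ε₁).app (L.log.obj x₀)) → HEq m₂ ((T.iota v₀ ε₂).app (L.log.obj x₀)) →
        HEq m₃ ((T.iota v₀ ε₃).app x₀) → HEq m₄ ((T.iota v₀ ε₄).app x₀) →
          (L.lam v₀ νu ⋙ L.forget v₀).map a ≫ m₁ ≫ m₂ ≫ m₃ ≠ m₄) :
    L.Cor55LogWall T := by
  obtain ⟨νu, νm, νc, hu, hm, hc, ⟨ε₁⟩, ⟨ε₂⟩, ⟨ε₃⟩, ⟨ε₄⟩⟩ := exists_logTwoPath_of_eq_false (isArc v₀) hv₀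
  exact L.cor55LogWall_of_twoPathObstruction T v₀ νu νm νc hu hm hc ε₁ ε₂ ε₃ ε₄ x₀
    (obstruction νu νm νc hu hm hc ε₁ ε₂ ε₃ ε₄)

end LogFrobeniusSetting

end Literature.AnabelianGeometry.AbsoluteAnabelian
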